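import Summits.BirchSwinnertonDyer.BirchSwinnertonDyer.Theorems.AdditiveBranchIMCGordTwoRankOneHeegnerKolyvaginSelfTwistUnits
import Summits.BirchSwinnertonDyer.BirchSwinnertonDyer.Theorems.AdditiveBranchIMCGordTwoRankOneHeegnerKolyvaginSelfTwistFrame
import HarnessLib

/-!
# Route `AdditiveBranchIMC` (rung K1), crux `GordTwoRankOne` (item 19358): the HEIGHT-FREE
# Heegner–Kolyvagin road — Part 22b: the self-twist frame WITH THE UNIT TERM — every `p ≡ 3 (mod 4)`,
# `p = 3` (`K = ℚ(√−3)`, `#𝓞_K^× = 6`) INCLUDED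
# (cell `bsd-addord`, second prover lane `bsd-addord-k1-c3x`, gen 5; `--supports 19358 --as helper` only)

HONEST FRAMING. THEOREMS ONLY: no definition, no new named fact, no `sorry`; nothing is booked; BSD is
not proved by any of this; the crux, STEP L′ (item 20498) and the sibling's crux 21398 stay OPEN at class
level. Parts 21a–d (p573821, p574812, p575175, p576401) built the self-twist frame `K = ℚ(√−p)` under
`p ∤ #𝓞_K^×`, i.e. `p ≥ 5`; Part 22a (p576648) re-proved the transposed Gross–Zagier identity keeping the unit term
`2·v_p #𝓞_K^×`. THIS FILE runs the frame on it: the LOWER half of `BSD(E,p)` on the self-twist rows of cell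
(G-ord, `e = 2`) at EVERY `p ≡ 3 (mod 4)` — at `p = 3` the field is `ℚ(√−3) = ℚ(ζ₃)` with `w = 6`, and the typed input
(the Jetchev–Skinner–Wan inequality for the GOOD ordinary `(−3)`-twist `V` over `ℚ(ζ₃)`) carries the BSD-consistent
slack `2·v₃(6) = 2`: `2·v₃[V(K):ℤP] ≤ v₃ #Ш(V/K) + v₃ ∏c(V) + v₃ ∏c(E) + 2` (equality under BSD(V,3) ∧ BSD(E,3) by
Part 22a; Gross–Zagier's `u² = 9`). The (3, X4) rank-one rows of the cell with `ρ̄_{E,3}` onto, every prime of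
`N_E/9` `≡ 1 (mod 3)` and `L(E^{(−3)},1) ≠ 0` are thereby reduced to ONE typed input about a curve GOOD ORDINARY at
`3` over `ℚ(ζ₃)` — no additive prime, no twisted branch, no height, no Manin rider (Mazur at the good prime `3 ∤ N_V`).
The tree's K-side `ℚ(ζ₃)` files of team n1011 (`Additive/XGordRankOne…CyclotomicThreeLowerK`) reach such rows on the
CYCLOTOMIC road with three typed inputs ((⊇/K), Schneider/K, branch p-adic Gross–Zagier); this is the Heegner road.
HONEST LIMIT at `p = 3`: Kolyvagin's bound as typed (`v #Ш(V/K) ≤ 2v[V(K):ℤP]`) is weaker than BSD by `2v₃(w/2) = 2`,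
so no UPPER / `BSD_p` door is offered at `p = 3` (LOWER is the crux's content).

* `missingLowerBoundAt_twist_of_upper_of_indexBound_units`, `missingLowerBoundAt_of_selfTwistFrame_units` (pointwise),
  `cellGordTwo_missingLowerBoundAt_rankOne_of_selfTwistIndexBoundUnits` (CLASS level, `p % 4 = 3`, no `5 ≤ p`).

References: [JetchevSkinnerWan2017] §7.4.1; [GrossZagier1986] I.§3, I.(6.5), V.§2; [CaiShuTian2014] Thm. 1.1;
[McCallumLMS1991] §1; [Wuthrich2014] Prop. 21; [Mazur1978] Cor. 4.1; [SilvermanAEC2009] VII.1 Prop. 1.3(b), X.5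
Cor. 5.4; [Miller2011LMS] Def. 1.1.
-/

set_option autoImplicit false
set_option linter.dupNamespace false
noncomputable section

open scoped Classical NumberField
open WeierstrassCurve NumberField IsDedekindDomain
  Literature.NumberTheory.EllipticCurves Literature.NumberTheory.EllipticCurves.ModularForms
  Literature.NumberTheory.EllipticCurves.Rank1Residual
  Literature.NumberTheory.EllipticCurves.Rank1Residual.Typed
  Summit.BirchSwinnertonDyer.Rank1Residual
  Summit.BirchSwinnertonDyer.Rank1Residual.Additive

namespace Summit.BirchSwinnertonDyer.BirchSwinnertonDyer.Theorems.AdditiveBranchIMCGordTwoRankOne.HeegnerKolyvagin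

/-! ### §6 The LOWER half and the self-twist frame WITH THE UNIT TERM (every `p ≡ 3 (mod 4)`, `p = 3` included) -/

/-- **THE LOWER HALF FOR THE TWIST, unit term kept** (Part 21b's `missingLowerBoundAt_twist_of_upper_of_indexBound`
without `p ∤ #𝓞_K^×`): LOWER(Wd) ⟸ UPPER(W) (rank `0`) + `ord_p u(Cd) = 0` + the BSD-consistent JSW inequality
`2·v_p[W(K):ℤP] ≤ v_p #Ш(W/K) + v_p ∏c(W) + v_p ∏c(Wd) + 2·v_p #𝓞_K^×` (equality under `BSD(W,p) ∧ BSD(Wd,p)` by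
`exists_shaAn_twist_padicVal_eq_of_heegner_rankZero_units`). ANY imaginary quadratic `K` with the Heegner hypothesis
for `N_W`. [cite: JetchevSkinnerWan2017, §7.4.1 (eq:shalower), pp. 30–31] [cite: GrossZagier1986, I.(6.5)]
[cite: Miller2011LMS, Def. 1.1] -/
theorem missingLowerBoundAt_twist_of_upper_of_indexBound_units
    (W : WeierstrassCurve ℚ) [W.IsElliptic] [W.IsGloballyMinimal] (p : ℕ) [Fact p.Prime]
    (N : ℕ) [NeZero N] (K : Type) [Field K] [NumberField K]
    (Dt : ModularParametrizationData W N) (H : HeegnerDatum N (NumberField.discr K)) (ι : K →+* ℂ)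
    (P : (W.baseChange K).toAffine.Point)
    (hGZ : gross_zagier N W K) (hKo : kolyvagin N W K)
    (hGZK : rank_eq_analyticRank_of_analyticRank_le_one) (hmod : hasEntireLFunction_rat)
    (hK : IsImaginaryQuadratic K) (hHN : SatisfiesHeegnerHypothesis N K)
    (hP : WeierstrassCurve.Affine.Point.map ι.toRatAlgHom P = heegnerPointComplex Dt H)
    (hp2 : p ≠ 2) (hc : ¬ (p : ℤ) ∣ Dt.c)
    (hr : W.analyticRank = 0) (hUW : Typed.MissingUpperBoundAt W p)
    (Wd : WeierstrassCurve ℚ) [Wd.IsElliptic] [Wd.IsGloballyMinimal] (Cd : VariableChange ℚ)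
    (hWd : Cd • W.quadraticTwist (NumberField.discr K : ℚ) = Wd)
    (hu : padicValRat p (Cd.u : ℚ) = 0) (hrd : Wd.analyticRank = 1)
    (hL : Finite (W.baseChange K).sha →
      (2 * padicValNat p (AddSubgroup.zmultiples P).index : ℤ) ≤
        padicValNat p (W.baseChange K).shaOrder + padicValNat p W.tamagawaProduct +
          padicValNat p Wd.tamagawaProduct + 2 * padicValNat p (Units.torsionOrder K)) :
    Typed.MissingLowerBoundAt Wd p := by
  obtain ⟨q', hq', hup⟩ := hUW
  obtain ⟨hqW, hvqW⟩ :=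
    exists_centralValue_div_realPeriod_eq_of_shaAn_eq_rankZero hGZK hmod W p hr hq'
  obtain ⟨-, hfinK, hsha, q, hq, hval⟩ := exists_shaAn_twist_padicVal_eq_of_heegner_rankZero_units W p N K
    Dt H ι P hGZ hKo hGZK hmod hK hHN hP hp2 hc hr _ hqW Wd Cd hWd hrd
  refine ⟨q, hq, ?_⟩
  have e1 := hL hfinK
  have e2 : (padicValNat p (W.baseChange K).shaOrder : ℤ) =
      padicValNat p W.shaOrder + padicValNat p Wd.shaOrder := by exact_mod_cast hsha
  rw [hvqW, hu] at hval
  omega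

/-- **THE POINTWISE LOWER HALF ON THE SELF-TWIST FRAME, unit term kept** (Part 21c's
`missingLowerBoundAt_of_selfTwistFrame_of_wuthrich` without `p ∤ #𝓞_K^×`, so `p = 3`, `K = ℚ(√−3)` is allowed):
`V` GOOD at the odd `p` with `L(V,1) ≠ 0`, `K` imaginary quadratic with `d_K = −p` and the Heegner hypothesis for
`N_V`, `E = W = Cd • V^{(d_K)}` globally minimal of analytic rank `1` with `ρ̄_{E,p}` onto (UPPER(V) by Wuthrich 2014
Prop. 21), a Heegner frame of `V` with `p ∤ c`; THE typed input: `2·v_p[V(K):ℤP] ≤ v_p #Ш(V/K) + v_p ∏c(V) + v_p ∏c(E)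
+ 2·v_p #𝓞_K^×`. CONCLUSION `Typed.MissingLowerBoundAt W p`. [cite: JetchevSkinnerWan2017, §7.4.1 (eq:shalower)]
[cite: Wuthrich2014, Prop. 21 (p. 400)] [cite: SilvermanAEC2009, X.5 Cor. 5.4 and VII.1 Prop. 1.3(b)] -/
theorem missingLowerBoundAt_of_selfTwistFrame_units
    (hGZK : rank_eq_analyticRank_of_analyticRank_le_one) (hmod : hasEntireLFunction_rat)
    (hW21 : Wuthrich2014.sha_dvd_analyticSha)
    (W : WeierstrassCurve ℚ) [W.IsElliptic] [W.IsGloballyMinimal] (p : ℕ) [Fact p.Prime] (hp2 : p ≠ 2)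
    (hr : W.analyticRank = 1) (hsurj : W.HasSurjectiveModNGaloisRep p)
    (V : WeierstrassCurve ℚ) [V.IsElliptic] [V.IsGloballyMinimal] (N : ℕ) [NeZero N]
    (K : Type) [Field K] [NumberField K] (hK : IsImaginaryQuadratic K)
    (hdisc : NumberField.discr K = -(p : ℤ))
    (Cd : VariableChange ℚ) (hCd : Cd • V.quadraticTwist (NumberField.discr K : ℚ) = W)
    (hVgood : V.HasGoodReductionAtPrime p) (hLV : V.entireLFunction 1 ≠ 0)
    (hHN : SatisfiesHeegnerHypothesis N K) (hGZ : gross_zagier N V K) (hKo : kolyvagin N V K)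
    (Dt : ModularParametrizationData V N) (H : HeegnerDatum N (NumberField.discr K)) (ι : K →+* ℂ)
    (P : (V.baseChange K).toAffine.Point)
    (hP : WeierstrassCurve.Affine.Point.map ι.toRatAlgHom P = heegnerPointComplex Dt H) (hc : ¬ (p : ℤ) ∣ Dt.c)
    (hL : Finite (V.baseChange K).sha →
      (2 * padicValNat p (AddSubgroup.zmultiples P).index : ℤ) ≤
        padicValNat p (V.baseChange K).shaOrder + padicValNat p V.tamagawaProduct +
          padicValNat p W.tamagawaProduct + 2 * padicValNat p (Units.torsionOrder K)) :
    Typed.MissingLowerBoundAt W p := by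
  have hr0 : V.analyticRank = 0 := (V.analyticRank_eq_zero_iff_holds (hmod V)).2 hLV
  have hD0 : (NumberField.discr K : ℚ) ≠ 0 := by exact_mod_cast NumberField.discr_ne_zero K
  have hu : padicValRat p (Cd.u : ℚ) = 0 :=
    padicValRat_u_eq_zero_of_good_of_twist_discr_eq_neg V W p hp2 hVgood K hdisc Cd hCd
  have hsurjV : V.HasSurjectiveModNGaloisRep p := by
    have h := (GaloisImage.hasSurjectiveModNGaloisRep_pow_iff_of_model_twist V p hD0 ⟨Cd, hCd⟩ 1)
    rw [pow_one] at h
    exact h.mp hsurj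
  have hUV : Typed.MissingUpperBoundAt V p :=
    Typed.missingUpperBoundAt_of_wuthrich V p hW21 hGZK hmod hp2 hr0
      (WeierstrassCurve.HasGoodReduction.not_hasAdditiveReduction (R := ℤ_[p]) hVgood) (Or.inr hsurjV)
  exact missingLowerBoundAt_twist_of_upper_of_indexBound_units V p N K Dt H ι P hGZ hKo hGZK hmod hK hHN hP hp2 hc
    hr0 hUV W Cd hCd hu hr hL

/-- **CELL LEVEL, unit term kept: the LOWER half of `BSD(E,p)` on the self-twist rows of cell (G-ord, `e = 2`) at
EVERY `p ≡ 3 (mod 4)`, `p = 3` INCLUDED** (Part 21c's class theorem without `5 ≤ p`). Rows: `ord_{s=1}L(E,s) = 1`,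
CellGordTwo, `p ≡ 3 (mod 4)`, `ρ̄_{E,p}` onto, every `ℓ ∣ N_E`, `ℓ ≠ p`, SPLIT in `K` (`d_K = −p`; at `p = 3`: every
`ℓ ∣ N_E/9` is `≡ 1 (mod 3)`, in particular `N_E/9` odd), `L(E^{(−p)},1) ≠ 0`. PUBLISHED binders as in Part 21c; THE
typed input `hL`: the JSW inequality WITH THE UNIT TERM for the good-ordinary `p*`-twist `V` over `K` at a
Manin-good frame (`X11b.exists_maninDatum_of_good`: Mazur 1978 at the GOOD prime `p` of `V`, valid at `p = 3`).
[cite: JetchevSkinnerWan2017, §7.4.1 (eq:shalower), pp. 30–31] [cite: GrossZagier1986, I.§3 and I.(6.5)]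
[cite: Mazur1978, Cor. 4.1] [cite: Wuthrich2014, Prop. 21 (p. 400)] -/
theorem cellGordTwo_missingLowerBoundAt_rankOne_of_selfTwistIndexBoundUnits
    (hGZ : ∀ (N : ℕ) [NeZero N] (V : WeierstrassCurve ℚ) (K : Type) [Field K] [NumberField K], gross_zagier N V K)
    (hKo : ∀ (N : ℕ) [NeZero N] (V : WeierstrassCurve ℚ) (K : Type) [Field K] [NumberField K], kolyvagin N V K)
    (hGZK : rank_eq_analyticRank_of_analyticRank_le_one) (hmod : hasEntireLFunction_rat)
    (hW21 : Wuthrich2014.sha_dvd_analyticSha) (hnf : exists_isNewformOf)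
    (hMaz : mazur_not_dvd_maninConstant_of_odd) (hNS : integral_neronScaling_of_isGloballyMinimal)
    (hL : ∀ (V : WeierstrassCurve ℚ) [V.IsElliptic] [V.IsGloballyMinimal] (p : ℕ) [Fact p.Prime]
      [NeZero (V.conductorNorm ℤ)] (K : Type) [Field K] [NumberField K]
      (W : WeierstrassCurve ℚ) [W.IsElliptic] [W.IsGloballyMinimal] (Cd : VariableChange ℚ)
      (Dt : ModularParametrizationData V (V.conductorNorm ℤ)) (H : HeegnerDatum (V.conductorNorm ℤ) (NumberField.discr K))
      (ι : K →+* ℂ) (P : (V.baseChange K).toAffine.Point),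
      V.HasGoodReductionAtPrime p → V.entireLFunction 1 ≠ 0 → V.HasSurjectiveModNGaloisRep p →
      IsImaginaryQuadratic K → NumberField.discr K = -(p : ℤ) → SatisfiesHeegnerHypothesis (V.conductorNorm ℤ) K →
      Cd • V.quadraticTwist (NumberField.discr K : ℚ) = W → W.analyticRank = 1 → N10.CellGordTwo W p →
      WeierstrassCurve.Affine.Point.map ι.toRatAlgHom P = heegnerPointComplex Dt H → ¬ (p : ℤ) ∣ Dt.c →
      Finite (V.baseChange K).sha →
      (2 * padicValNat p (AddSubgroup.zmultiples P).index : ℤ) ≤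
        padicValNat p (V.baseChange K).shaOrder + padicValNat p V.tamagawaProduct + padicValNat p W.tamagawaProduct +
          2 * padicValNat p (Units.torsionOrder K)) :
    ∀ (W : WeierstrassCurve ℚ) [W.IsElliptic] [W.IsGloballyMinimal] (p : ℕ) [Fact p.Prime]
      (K : Type) [Field K] [NumberField K],
      W.analyticRank = 1 → N10.CellGordTwo W p → p % 4 = 3 → W.HasSurjectiveModNGaloisRep p →
      IsImaginaryQuadratic K → NumberField.discr K = -(p : ℤ) →
      (∀ ℓ : ℕ, ℓ.Prime → (ℓ : ℤ) ∣ ↑(W.conductorNorm ℤ) → ℓ ≠ p →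
        ((Ideal.span {(ℓ : ℤ)}).primesOver (𝓞 K)).ncard = 2) →
      (W.quadraticTwist (-(p : ℚ))).entireLFunction 1 ≠ 0 →
      Typed.MissingLowerBoundAt W p := by
  intro W _ _ p _ K _ _ hr hc2 hp4 hsurj hK hdisc hHeeg hLt
  have hp : p.Prime := Fact.out
  obtain ⟨hp2, hadd, hG, he⟩ := hc2
  -- the good ordinary `p*`-twist `V`, `p* = −p = d_K`
  obtain ⟨V, _, _, ⟨C, hC⟩, hord⟩ := TypeGOrd.exists_goodOrd_model_twist_pStar W p hp2 hG hadd he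
  have hVgood : V.HasGoodReductionAtPrime p := hord.1
  have hodd : Odd (p / 2) := ⟨p / 4, by omega⟩
  have hps : ((-1 : ℚ) ^ (p / 2) * p) = (NumberField.discr K : ℚ) := by
    rw [hodd.neg_one_pow, hdisc]; push_cast; ring
  have hD0 : (NumberField.discr K : ℚ) ≠ 0 := by exact_mod_cast NumberField.discr_ne_zero K
  have hC' : C • W.quadraticTwist (NumberField.discr K : ℚ) = V := by rw [← hps]; exact hC
  obtain ⟨Cd, hCd⟩ := exists_variableChange_quadraticTwist_symm V W hD0 ⟨C, hC'⟩
  have hCd' : Cd • V.quadraticTwist ((-1 : ℚ) ^ (p / 2) * p) = W := by rw [hps]; exact hCd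
  haveI : NeZero (V.conductorNorm ℤ) := ⟨(V.conductorNorm_pos_holds).ne'⟩
  -- the Heegner hypothesis for `N_V`
  have hHN : SatisfiesHeegnerHypothesis (V.conductorNorm ℤ) K := by
    intro ℓ hℓ hℓV
    have hℓV' : ℓ ∣ V.conductorNorm ℤ := by exact_mod_cast hℓV
    have hℓW : ℓ ∣ W.conductorNorm ℤ :=
      AdditiveBranchIMCMultLower.dvd_conductorNorm_of_dvd_conductorNorm_twist_model hp2 V W Cd hCd' hadd hℓ hℓV'
    have hℓp : ℓ ≠ p := by
      rintro rfl
      exact (V.dvd_conductorNorm_iff_not_hasGoodReductionAtPrime ℓ).mp hℓV' hVgood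
    exact hHeeg ℓ hℓ (by exact_mod_cast hℓW) hℓp
  -- the image of `V`
  have hsurjV : V.HasSurjectiveModNGaloisRep p := by
    have h := (GaloisImage.hasSurjectiveModNGaloisRep_pow_iff_of_model_twist V p hD0 ⟨Cd, hCd⟩ 1)
    rw [pow_one] at h
    exact h.mp hsurj
  haveI : NeZero (p : ℚ) := ⟨by exact_mod_cast hp.ne_zero⟩
  have hirrV : V.HasIrreducibleModPGaloisRep p := hasIrreducibleModPGaloisRep_of_hasSurjectiveModNGaloisRep V p hsurjV
  -- `L(V,1) ≠ 0`
  have hLV : V.entireLFunction 1 ≠ 0 := by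
    haveI : (W.quadraticTwist (NumberField.discr K : ℚ)).IsElliptic := W.isElliptic_quadraticTwist hD0
    have hVL : V.entireLFunction = (W.quadraticTwist (NumberField.discr K : ℚ)).entireLFunction := by
      rw [← hC', entireLFunction_smul]
    have hdq : (NumberField.discr K : ℚ) = -(p : ℚ) := by rw [hdisc]; push_cast; ring
    rw [hVL, hdq]; exact hLt
  -- the Manin-good Heegner frame of `V` over `K`
  obtain ⟨Dt, H, ι, P, hP, hc⟩ :=
    X11b.exists_maninDatum_of_good hnf hMaz hNS V p (V.conductorNorm ℤ) K rfl hp2 hVgood hirrV hK hHN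
  exact missingLowerBoundAt_of_selfTwistFrame_units hGZK hmod hW21 W p hp2 hr hsurj V (V.conductorNorm ℤ) K hK hdisc Cd
    hCd hVgood hLV hHN (hGZ _ V K) (hKo _ V K) Dt H ι P hP hc
    (hL V p K W Cd Dt H ι P hVgood hLV hsurjV hK hdisc hHN hCd hr ⟨hp2, hadd, hG, he⟩ hP hc)

end Summit.BirchSwinnertonDyer.BirchSwinnertonDyer.Theorems.AdditiveBranchIMCGordTwoRankOne.HeegnerKolyvagin

end
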